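import Literature.AlgebraicGeometry.Motives.HodgeNumberHarmonicFrames
import Literature.AlgebraicGeometry.Motives.HodgeDecompositionHarmonicRepresentativeProofs
import Literature.NumberTheory.Transcendental.KaehlerHodgePreHilbert
import Literature.NumberTheory.Transcendental.DeRhamTheorem
import Literature.Geometry.Kaehler.ManifoldFormsPullback

/-!
# Route NoetherLefschetzOneUp — `GenericGeometricGenus`: transport of harmonic `(p,q)`-forms along a diffeomorphism (u.s.c. of Hodge numbers, step 2a)

Helper for item stmt-HodgeConjecture-15374 (missing input: Voisin I Cor. 9.19 for the smooth
family of a net). Step 1 (`Theorems/NoetherLefschetzOneUpGenericGeometricGenusHarmonicLimit`, the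
harmonic limit lemma) consumes, on the central fibre `M₀`, subspaces `W_i ≤ A^k(M₀; ℂ)` of closed
forms with forms `B_i` killing `(exact, W_i)` and maps `L_i` fixing `W_i`. This file produces that
ALGEBRAIC data for ONE other fibre: given compact manifolds `M₀` (smooth metric, orientation family
with smooth volume form) and `M₁` (compact KÄHLER, holomorphic atlas), and a `C^∞` diffeomorphism
`Φ : M₀ → M₁` with inverse `Ψ`, the subspace `W = Φ^*(harmonic (p,q)-forms of M₁) ≤ A^k(M₀; ℂ)`
satisfies (`exists_transported_harmonic_subspace`):

* every `w ∈ W` is `Φ^* u` for a `Δ_d`-harmonic `(p,q)`-form `u` on `M₁`, and conversely;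
* `W` consists of CLOSED forms (`d` commutes with pull-back; harmonic forms are closed);
* `(Ψ^* d, Ψ^* w)_{L²(M₁)} = 0` for `d` exact on `M₀`, `w ∈ W` — the transported `L²` product
  `B(d, w)` kills `(exact, W)` (`Ψ^* d` is exact, `Ψ^* Φ^* u = u` is harmonic, harmonic ⊥ exact);
* `Φ^* ((Ψ^* w)^{p,q}) = w` for `w ∈ W` — the transported type projection `L` fixes `W`;
* `W` contains `h^{p,q}(M₁) = dim hodgePQ E₁ M₁ k p q` linearly independent forms (the pull-backs
  of `h^{p,q}(M₁)` independent harmonic `(p,q)`-forms, `Motives/HodgeNumberHarmonicFrames`; `Φ^*` is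
  injective).

The ESTIMATES (`B` is `ε`-close to the `L²` product of `M₀`, `L` is `η`-close to the type projection
of `M₀`, when `Φ^* g₁` is close to `g₀` and `Φ^* J₁` to `J₀`) are step 2b; the geometry of the
family (fibre models, Ehresmann trivialisation, convergence) is step 3.
-/

set_option linter.dupNamespace false

noncomputable section

open scoped Manifold ContDiff Topology ComplexConjugate
open Bundle Module Set Finset Filter
open Literature.Geometry.Kaehler Literature.NumberTheory.Transcendental
open Literature.AlgebraicGeometry.Motives

namespace Summit.HodgeConjecture.HodgeConjecture.Theorems

variable {E₀ : Type*} [NormedAddCommGroup E₀] [NormedSpace ℂ E₀] [FiniteDimensional ℂ E₀]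
  {E₁ : Type*} [NormedAddCommGroup E₁] [NormedSpace ℂ E₁] [FiniteDimensional ℂ E₁]
  {n : ℕ} [Fact (finrank ℝ E₀ = n)] [Fact (finrank ℝ E₁ = n)]
  [MeasurableSpace E₀] [BorelSpace E₀] [MeasurableSpace E₁] [BorelSpace E₁]
  {M₀ : Type*} [TopologicalSpace M₀] [ChartedSpace E₀ M₀] [IsManifold 𝓘(ℝ, E₀) ∞ M₀]
  [T2Space M₀] [CompactSpace M₀]
  {M₁ : Type*} [TopologicalSpace M₁] [ChartedSpace E₁ M₁] [IsManifold 𝓘(ℝ, E₁) ∞ M₁]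
  [IsManifold 𝓘(ℂ, E₁) ω M₁] [T2Space M₁] [CompactSpace M₁]
  (o₀ : (x : M₀) → Orientation ℝ (TangentSpace 𝓘(ℝ, E₀) x) (Fin n))
  (g₁ : ContMDiffRiemannianMetric 𝓘(ℝ, E₁) ∞ E₁ (fun x : M₁ ↦ TangentSpace 𝓘(ℝ, E₁) x))
  (o₁ : (x : M₁) → Orientation ℝ (TangentSpace 𝓘(ℝ, E₁) x) (Fin n))

omit [FiniteDimensional ℂ E₀] [Fact (finrank ℝ E₀ = n)] [IsManifold 𝓘(ℝ, E₀) ∞ M₀]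
  [FiniteDimensional ℂ E₁] [MeasurableSpace E₀] [BorelSpace E₀] [MeasurableSpace E₁] [BorelSpace E₁]
  [T2Space M₀] [CompactSpace M₀] [IsManifold 𝓘(ℝ, E₁) ∞ M₁] [IsManifold 𝓘(ℂ, E₁) ω M₁]
  [T2Space M₁] [CompactSpace M₁] in
/-- Pull-back of complex forms commutes with complex scalars (`cpullbackₗ` is `ℂ`-linear). [folklore] -/
theorem pullback_complex_smul {k : ℕ} (f : M₀ → M₁) (c : ℂ) (β : MForm 𝓘(ℝ, E₁) M₁ ℂ k) :
    (c • β).pullback 𝓘(ℝ, E₀) f = c • β.pullback 𝓘(ℝ, E₀) f := by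
  rw [← MForm.cpullbackₗ_apply, map_smul, MForm.cpullbackₗ_apply]

omit [FiniteDimensional ℂ E₀] [FiniteDimensional ℂ E₁] [Fact (finrank ℝ E₀ = n)]
  [Fact (finrank ℝ E₁ = n)] [MeasurableSpace E₀] [BorelSpace E₀] [MeasurableSpace E₁] [BorelSpace E₁]
  [IsManifold 𝓘(ℝ, E₀) ∞ M₀] [T2Space M₀] [CompactSpace M₀] [IsManifold 𝓘(ℝ, E₁) ∞ M₁]
  [IsManifold 𝓘(ℂ, E₁) ω M₁] [T2Space M₁] [CompactSpace M₁] in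
/-- `Ψ^* Φ^* u = u` for `Φ ∘ Ψ = id` (functoriality of the pull-back, Warner 2.22). [cite: WarnerGTM94, 2.22] -/
theorem pullback_pullback_eq_self {k : ℕ} {Φ : M₀ → M₁} {Ψ : M₁ → M₀}
    (hΦ : ContMDiff 𝓘(ℝ, E₀) 𝓘(ℝ, E₁) ∞ Φ) (hΨ : ContMDiff 𝓘(ℝ, E₁) 𝓘(ℝ, E₀) ∞ Ψ)
    (hΦΨ : Φ ∘ Ψ = id) (u : MForm 𝓘(ℝ, E₁) M₁ ℂ k) :
    (u.pullback 𝓘(ℝ, E₀) Φ).pullback 𝓘(ℝ, E₁) Ψ = u := by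
  rw [← MForm.pullback_comp (hΦ.mdifferentiable (by simp)) (hΨ.mdifferentiable (by simp)), hΦΨ,
    MForm.pullback_id]

/-- **Transport of the harmonic `(p,q)`-forms of a Kähler manifold along a diffeomorphism (step 2a
of the upper semicontinuity of Hodge numbers).** Let `M₀` be a compact manifold with a smooth
metric and an orientation family `o₀` with smooth volume form (so that `A^k(M₀; ℂ) = CL2SmoothForms o₀ k`
is a pre-Hilbert space), `(M₁, g₁, o₁)` a compact Kähler manifold with holomorphic atlas and `vol_{o₁}`
smooth, and `C^∞` maps `Φ : M₀ → M₁`, `Ψ : M₁ → M₀` with `Φ ∘ Ψ = id` (only this half of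
'mutually inverse' is used). Then the subspace
`W = Φ^*(ℋ^{p,q}(M₁)) ≤ A^k(M₀; ℂ)` of pull-backs of `Δ_d`-harmonic `(p,q)`-forms of `M₁` consists of
closed forms, the transported `L²` product kills `(exact, W)` (`(Ψ^*d, Ψ^*w)_{L²(M₁)} = 0`), the
transported type projection fixes `W` (`Φ^*((Ψ^*w)^{p,q}) = w`), and `W` contains `h^{p,q}(M₁)`
linearly independent forms (pull-backs of the harmonic frame of `Motives/HodgeNumberHarmonicFrames`).
These are the hypotheses `hWc`, `hB0`, `hLfix`, `hN` of the harmonic limit lemma for the fibre `M₁`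
read on `M₀`. [cite: VoisinHodgeI2002, §9.3.1 Cor. 9.19 and §6.1.3 Prop. 6.11] [cite: Kodaira2005, Thm. 7.3] -/
theorem exists_transported_harmonic_subspace
    [RiemannianBundle (fun x : M₀ ↦ TangentSpace 𝓘(ℝ, E₀) x)]
    [IsContMDiffRiemannianBundle 𝓘(ℝ, E₀) ∞ E₀ (fun x : M₀ ↦ TangentSpace 𝓘(ℝ, E₀) x)]
    [Fact (IsSmoothForm (riemannianVolumeForm o₀))]
    (hg₁ : g₁.toRiemannianMetric.IsKaehler) {k m : ℕ} (h : k + m = n) {p q : ℕ} (hpq : p + q = k)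
    {Φ : M₀ → M₁} {Ψ : M₁ → M₀} (hΦ : ContMDiff 𝓘(ℝ, E₀) 𝓘(ℝ, E₁) ∞ Φ)
    (hΨ : ContMDiff 𝓘(ℝ, E₁) 𝓘(ℝ, E₀) ∞ Ψ) (hΦΨ : Φ ∘ Ψ = id) :
    letI : RiemannianBundle (fun x : M₁ ↦ TangentSpace 𝓘(ℝ, E₁) x) := ⟨g₁.toRiemannianMetric⟩
    IsSmoothForm (riemannianVolumeForm o₁) →
    ∃ W : Submodule ℂ (CL2SmoothForms o₀ k),
      (∀ w ∈ W, ∃ u : MForm 𝓘(ℝ, E₁) M₁ ℂ k, IsCHarmonicForm o₁ h u ∧ IsOfType p q u ∧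
          CL2SmoothForms.toForm o₀ w = u.pullback 𝓘(ℝ, E₀) Φ) ∧
      (∀ u : MForm 𝓘(ℝ, E₁) M₁ ℂ k, IsCHarmonicForm o₁ h u → IsOfType p q u →
          ∀ hs : IsSmoothForm (u.pullback 𝓘(ℝ, E₀) Φ), CL2SmoothForms.mk o₀ (u.pullback 𝓘(ℝ, E₀) Φ) hs ∈ W) ∧
      (∀ w ∈ W, CL2SmoothForms.toForm o₀ w ∈ cclosedSmoothForms E₀ M₀ k) ∧
      (∀ w ∈ W, ∀ d : MForm 𝓘(ℝ, E₀) M₀ ℂ k, d ∈ cexactSmoothForms E₀ M₀ k →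
          MForm.cl2Inner o₁ (d.pullback 𝓘(ℝ, E₁) Ψ)
            ((CL2SmoothForms.toForm o₀ w).pullback 𝓘(ℝ, E₁) Ψ) = 0) ∧
      (∀ w ∈ W, (((CL2SmoothForms.toForm o₀ w).pullback 𝓘(ℝ, E₁) Ψ).typeComponent p q).pullback
          𝓘(ℝ, E₀) Φ = CL2SmoothForms.toForm o₀ w) ∧
      ∃ f : Fin (finrank ℂ ↥(hodgePQ E₁ M₁ k p q)) → CL2SmoothForms o₀ k,
        LinearIndependent ℂ f ∧ ∀ j, f j ∈ W := by
  letI : RiemannianBundle (fun x : M₁ ↦ TangentSpace 𝓘(ℝ, E₁) x) := ⟨g₁.toRiemannianMetric⟩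
  haveI : IsContMDiffRiemannianBundle 𝓘(ℝ, E₁) ∞ E₁ (fun x : M₁ ↦ TangentSpace 𝓘(ℝ, E₁) x) :=
    ⟨g₁.inner, g₁.contMDiff, fun _ _ _ ↦ rfl⟩
  intro ho₁
  haveI : Fact (IsSmoothForm (riemannianVolumeForm o₁)) := ⟨ho₁⟩
  -- the `ℂ`-linear pull-back `Φ^* : A^k(M₁; ℂ) → A^k(M₀; ℂ)`
  have hsm : ∀ v : CL2SmoothForms o₁ k,
      IsSmoothForm ((CL2SmoothForms.toForm o₁ v).pullback 𝓘(ℝ, E₀) Φ) := fun v ↦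
    isSmoothForm_pullback hΦ (CL2SmoothForms.isSmoothForm_toForm o₁ v)
  let pull : CL2SmoothForms o₁ k →ₗ[ℂ] CL2SmoothForms o₀ k :=
    { toFun := fun v ↦ CL2SmoothForms.mk o₀ _ (hsm v)
      map_add' := fun a b ↦ Subtype.ext (by
        change (CL2SmoothForms.toForm o₁ (a + b)).pullback 𝓘(ℝ, E₀) Φ =
          (CL2SmoothForms.toForm o₁ a).pullback 𝓘(ℝ, E₀) Φ + (CL2SmoothForms.toForm o₁ b).pullback 𝓘(ℝ, E₀) Φ
        rw [CL2SmoothForms.toForm_add, MForm.pullback_add])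
      map_smul' := fun c a ↦ Subtype.ext (by
        change (CL2SmoothForms.toForm o₁ (c • a)).pullback 𝓘(ℝ, E₀) Φ =
          c • (CL2SmoothForms.toForm o₁ a).pullback 𝓘(ℝ, E₀) Φ
        rw [CL2SmoothForms.toForm_smul, pullback_complex_smul]) }
  have hpull : ∀ v, CL2SmoothForms.toForm o₀ (pull v) =
      (CL2SmoothForms.toForm o₁ v).pullback 𝓘(ℝ, E₀) Φ := fun v ↦ rfl
  -- `Φ^*` is injective: `Ψ^* Φ^* = id`
  have hinj : LinearMap.ker pull = ⊥ := by
    rw [LinearMap.ker_eq_bot']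
    intro v hv
    have h0 : (CL2SmoothForms.toForm o₁ v).pullback 𝓘(ℝ, E₀) Φ = 0 := by
      rw [← hpull, hv, CL2SmoothForms.toForm_zero]
    apply Subtype.ext
    change CL2SmoothForms.toForm o₁ v = CL2SmoothForms.toForm o₁ 0
    rw [CL2SmoothForms.toForm_zero, ← pullback_pullback_eq_self hΦ hΨ hΦΨ (CL2SmoothForms.toForm o₁ v),
      h0, MForm.pullback_zero]
  -- the harmonic `(p,q)`-forms of `M₁` inside `A^k(M₁; ℂ)`
  let H₁ : Submodule ℂ (CL2SmoothForms o₁ k) :=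
    { carrier := {v | IsCHarmonicForm o₁ h (CL2SmoothForms.toForm o₁ v) ∧
        IsOfType p q (CL2SmoothForms.toForm o₁ v)}
      zero_mem' := by
        change IsCHarmonicForm o₁ h (CL2SmoothForms.toForm o₁ (0 : CL2SmoothForms o₁ k)) ∧ _
        rw [CL2SmoothForms.toForm_zero]
        exact ⟨isCHarmonicForm_zero o₁ h, isOfType_zero hpq⟩
      add_mem' := fun {a b} ha hb ↦ by
        change IsCHarmonicForm o₁ h (CL2SmoothForms.toForm o₁ (a + b)) ∧ _
        rw [CL2SmoothForms.toForm_add]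
        exact ⟨ha.1.add o₁ ho₁ h hb.1, ha.2.add hb.2⟩
      smul_mem' := fun c {a} ha ↦ by
        change IsCHarmonicForm o₁ h (CL2SmoothForms.toForm o₁ (c • a)) ∧ _
        rw [CL2SmoothForms.toForm_smul]
        exact ⟨ha.1.smul o₁ h c, ha.2.smul c⟩ }
  refine ⟨H₁.map pull, ?_, ?_, ?_, ?_, ?_, ?_⟩
  · -- description of the elements of `W`
    intro w hw
    obtain ⟨v, hv, rfl⟩ := Submodule.mem_map.1 hw
    exact ⟨CL2SmoothForms.toForm o₁ v, hv.1, hv.2, hpull v⟩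
  · -- every pull-back of a harmonic `(p,q)`-form lies in `W`
    intro u hu ht hs
    refine Submodule.mem_map.2 ⟨CL2SmoothForms.mk o₁ u hu.1, ⟨hu, ht⟩, ?_⟩
    exact Subtype.ext rfl
  · -- `W` consists of closed forms
    intro w hw
    obtain ⟨v, hv, rfl⟩ := Submodule.mem_map.1 hw
    rw [hpull]
    exact pullback_mem_cclosedSmoothForms hΦ (mem_cclosedSmoothForms
      (CL2SmoothForms.isSmoothForm_toForm o₁ v) (mextDeriv_eq_zero_of_isCHarmonicForm o₁ ho₁ h hv.1))
  · -- the transported `L²` product kills `(exact, W)`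
    intro w hw d hd
    obtain ⟨v, hv, rfl⟩ := Submodule.mem_map.1 hw
    rw [hpull, pullback_pullback_eq_self hΦ hΨ hΦΨ, ← MForm.cl2Inner_conj_symm,
      cl2Inner_eq_zero_of_isCHarmonicForm_of_mem_cexactSmoothForms o₁ ho₁ h hv.1
        (pullback_mem_cexactSmoothForms hΨ hd), map_zero]
  · -- the transported type projection fixes `W`
    intro w hw
    obtain ⟨v, hv, rfl⟩ := Submodule.mem_map.1 hw
    rw [hpull, pullback_pullback_eq_self hΦ hΨ hΦΨ, hv.2.typeComponent_eq_self]
  · -- `h^{p,q}(M₁)` independent forms in `W`: pull back the harmonic `(p,q)`-frame of `M₁`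
    obtain ⟨u, hu, hut⟩ := exists_linearIndependent_isCHarmonicForm_isOfType g₁ o₁ hg₁ h p q ho₁
    let v : Fin (finrank ℂ ↥(hodgePQ E₁ M₁ k p q)) → CL2SmoothForms o₁ k := fun j ↦
      CL2SmoothForms.mk o₁ (u j) (hut j).2.1.1
    have hv : LinearIndependent ℂ v := by
      refine LinearIndependent.of_comp (CL2SmoothForms.toFormₗ o₁) ?_
      exact hu
    refine ⟨fun j ↦ pull (v j), hv.map' pull hinj, fun j ↦ ?_⟩
    exact Submodule.mem_map.2 ⟨v j, ⟨(hut j).2.1, (hut j).2.2⟩, rfl⟩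

end Summit.HodgeConjecture.HodgeConjecture.Theorems

end
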